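import Mathlib
import Summits.NavierStokesRegularity.NavierStokesRegularity.Theorems.ThreadingFluxHorizonTowerTwoFourSixDigits
import Summits.NavierStokesRegularity.NavierStokesRegularity.Theorems.ThreadingFluxHorizonTowerFiniteTowerClassPoly
import Summits.NavierStokesRegularity.NavierStokesRegularity.Theorems.ThreadingFluxHorizonTowerFiniteTowerThreeShell
import HarnessLib

/-!
# Crux `PoloidalLiouville` (stmt-NavierStokesRegularity-1222), crux idea «horizon-threading-tower» (ns-idea-15):
# FINITE TOWERS AT ORDER ONE — THM E: THE TOWER `{2, 4, 6}` IS COAXIALLY ZONAL (third cone digit)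

Support file (`--supports stmt-NavierStokesRegularity-1222`, helper; cell `ns-wall-extremal`, width hand ns-wall-eng-3 g5; 0 kit).

`{2, 4, 6}` was the smallest finite scale-free tower of horizon profiles NOT decided at order one by the four theorems of ns-wall-eng-3 g4
(THM A zonal top, THM B coprime top pair, THM C/C″ isolated third shell, THM D mixed parity; all degrees `≤ 6` are otherwise decided):
its degrees have one parity and its top pair `(4, 6)` is NOT coprime, so the null-cone digit of the top bracket only says
`chartT P₄ = c₁ q²`, `chartT P₆ = c₂ q³` — the top shells are the HARMONIC PROJECTIONS `c₁ · 35π₄(L²)`, `c₂ · 77π₆(L³)` of the powers of ONE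
harmonic quadratic `L = xᵀQx` (degree-two chart surjectivity + chart injectivity + reality of the generator, `…QuadraticGeneratorChart`).
The next two `ρ`-adic digits of the class identity `7ρ²{P₂,P₄} + 18ρ{P₂,P₆} + 11{P₄,P₆} = 0` (`…FiniteTowerClassPoly`,
`…TwoFourSixDigits`) force `Q² = βQ + γI`, i.e. `Q` UNIAXIAL (`…QuadraticGeneratorAxis`), so the top shell is zonal and THM A descends.

* ★★ `finiteTower_exists_axis_of_twoFourSix` (polynomial level), ★★ `finiteTower_zonal_of_twoFourSix` (three shells `A ∈ 𝓗₂` possibly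
  zero, `B ∈ 𝓗₄`, `C ∈ 𝓗₆` non-zero ⇒ one common axis), `finiteTower_zonalForm_of_twoFourSix` (zonal functional forms).

HONEST LABEL: ONE more cell (the first all-one-parity, non-coprime-top cell) of the crux-idea CONJECTURE `HorizonTowerZonality` at ORDER
ONE; the towers `{2,4,8}`, `{4,6,8}`, `{1,3,9}`, … and the general (infinite) tower stay OPEN; `PoloidalLiouville` (1222),
`UnthreadedRigidity` (27585) OPEN; W1 movement 0; NS regularity NOT proved.  [folklore]
-/

-- the summit and its single sub-problem share the name (CONVENTIONS §1)
set_option linter.dupNamespace false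

noncomputable section

open MvPolynomial Complex
open scoped Polynomial RealInnerProductSpace
open Literature.Analysis.FluidPDE (cross)

namespace Summit.NavierStokesRegularity.NavierStokesRegularity.Theorems.PoloidalLiouville.HorizonTower

/-! ### Polynomial level -/

/-- ★★ **THM E, polynomial level.**  In a scale-free tower `U_{H₂} + U_{H₄} + U_{H₆}` of horizon profiles (smooth homogeneous harmonic
shells) annihilated by the order-one horizon law off the centre, with polynomial models `P₄, P₆ ≠ 0`, the top shell is annihilated by the
rotation derivative about some real axis `n ≠ 0`. [folklore] -/
theorem finiteTower_exists_axis_of_twoFourSix (H : ℕ → E3 → ℝ)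
    (hH : ∀ l ∈ ({2, 4, 6} : Finset ℕ), ContDiff ℝ (⊤ : ℕ∞) (H l))
    (hhom : ∀ l ∈ ({2, 4, 6} : Finset ℕ), ∀ (c : ℝ) (y : E3), H l (c • y) = c ^ l * H l y)
    (hharm : ∀ l ∈ ({2, 4, 6} : Finset ℕ), ∀ y, Laplacian.laplacian (H l) y = 0)
    (hL1 : ∀ x : E3, x ≠ 0 → horizonL1 (fun z => ∑ l ∈ ({2, 4, 6} : Finset ℕ), horizonProfile l (H l) 0 z) 0 x = 0)
    (P : ℕ → MvPolynomial (Fin 3) ℝ)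
    (hP : ∀ l ∈ ({2, 4, 6} : Finset ℕ), (P l).IsHomogeneous l ∧ Zonal.lapP (P l) = 0 ∧ ∀ y, H l y = Zonal.evalE (P l) y)
    (hP4 : P 4 ≠ 0) (hP6 : P 6 ≠ 0) :
    ∃ n : Fin 3 → ℝ, n ≠ 0 ∧ Zonal.detP (C (n 0) * X 0 + C (n 1) * X 1 + C (n 2) * X 2) (P 6) = 0 := by
  classical
  have hK : ∀ l ∈ ({2, 4, 6} : Finset ℕ), 1 ≤ l := by
    intro l hl; simp only [Finset.mem_insert, Finset.mem_singleton] at hl; omega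
  have h2K : (2 : ℕ) ∈ ({2, 4, 6} : Finset ℕ) := by simp
  have h4K : (4 : ℕ) ∈ ({2, 4, 6} : Finset ℕ) := by simp
  have h6K : (6 : ℕ) ∈ ({2, 4, 6} : Finset ℕ) := by simp
  -- the class identity
  have hE := finiteTower_classIdentity_twoFourSix H hH hhom hharm hL1 P (fun l hl => (hP l hl).2.2)
  -- the top pair: weighted Wronskian law `4 f g′ = 6 g f′`
  set f : ℂ[X] := Zonal.chartT (map (algebraMap ℝ ℂ) (P 4)) with hf
  set g : ℂ[X] := Zonal.chartT (map (algebraMap ℝ ℂ) (P 6)) with hg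
  have hW := finiteTower_top_wronskian {2, 4, 6} H hK hH hhom hharm hL1 P (fun l hl => ⟨(hP l hl).1, (hP l hl).2.2⟩) h6K h4K
    (by norm_num) (by intro l hl; simp only [Finset.mem_insert, Finset.mem_singleton] at hl; omega)
    (by intro l hl hl6; simp only [Finset.mem_insert, Finset.mem_singleton] at hl; omega)
  have hW' : (2 : ℂ[X]) * f * Polynomial.derivative g = (3 : ℂ[X]) * g * Polynomial.derivative f := by
    have h2 : (2 : ℂ[X]) * ((2 : ℂ[X]) * f * Polynomial.derivative g - (3 : ℂ[X]) * g * Polynomial.derivative f) = 0 := by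
      rw [← hf, ← hg] at hW
      linear_combination hW
    exact sub_eq_zero.mp ((mul_eq_zero.mp h2).resolve_left two_ne_zero)
  have hWr := Zonal.wronskian_pow_pow_eq_zero (a := 2) (b := 3) (by norm_num) (by norm_num)
    (by exact_mod_cast hW')
  have hg0 : g ≠ 0 := fun h => hP6 (Zonal.eq_zero_of_chartT_map_eq_zero (hP 6 h6K).1 (hP 6 h6K).2.1 h)
  have hf0 : f ≠ 0 := fun h => hP4 (Zonal.eq_zero_of_chartT_map_eq_zero (hP 4 h4K).1 (hP 4 h4K).2.1 h)
  obtain ⟨c, hc⟩ := Zonal.exists_C_mul_of_wronskian_eq_zero (pow_ne_zero _ hg0) hWr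
  set lc : ℂ := g.leadingCoeff with hlc
  obtain ⟨q, hqm, hgq, hdeg⟩ := Zonal.exists_monic_eq_C_mul_pow_of_coprime (a := 3) (b := 2) (by decide) (by norm_num) hf0 hc
  rw [← hlc] at hgq
  have hq0 : q ≠ 0 := hqm.ne_zero
  -- `deg q ≤ 4`
  have hq4 : q.natDegree ≤ 4 := by
    have h1 : g.natDegree ≤ 2 * 6 := Zonal.natDegree_chartT_le (((hP 6 h6K).1).map (algebraMap ℝ ℂ))
    omega
  -- `f = γ q²`
  have hf3 : f ^ 3 = Polynomial.C (c * lc ^ 2) * (q ^ 2) ^ 3 := by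
    rw [hc, hgq, mul_pow, ← Polynomial.C_pow, ← mul_assoc, ← Polynomial.C_mul]; ring
  obtain ⟨γ, hγ⟩ := Zonal.exists_eq_C_mul_pow_of_pow_eq (D := 3) (d := 2) (by norm_num) hq0 hf3
  -- `q` is the chart of a complex generator
  obtain ⟨qa, qb, qd, qe, qf, hgen⟩ := Zonal.exists_gen_chartT_eq hq4
  rw [← hgen] at hγ hgq
  have hP4c : map (algebraMap ℝ ℂ) (P 4) = C (γ / 35) * Zonal.genA qa qb qd qe qf :=
    Zonal.eq_C_mul_genA_of_chartT_eq qa qb qd qe qf (((hP 4 h4K).1).map _)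
      (by rw [← Zonal.map_lapP, (hP 4 h4K).2.1, map_zero]) hγ
  have hP6c : map (algebraMap ℝ ℂ) (P 6) = C (lc / 77) * Zonal.genB qa qb qd qe qf :=
    Zonal.eq_C_mul_genB_of_chartT_eq qa qb qd qe qf (((hP 6 h6K).1).map _)
      (by rw [← Zonal.map_lapP, (hP 6 h6K).2.1, map_zero]) hgq
  -- reality of the generator
  obtain ⟨w, ra, rb, rd, re, rf, hwa, hwb, hwd, hwe, hwf⟩ := Zonal.exists_real_gen_of_map_eq_C_mul_genA hP4 hP4c
  rw [hwa, hwb, hwd, hwe, hwf] at hP4c hP6c hgen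
  have hmapA : map (algebraMap ℝ ℂ) (Zonal.genA ra rb rd re rf) = Zonal.genA (ra : ℂ) rb rd re rf := by
    rw [Zonal.map_genA]; rfl
  have hmapB : map (algebraMap ℝ ℂ) (Zonal.genB ra rb rd re rf) = Zonal.genB (ra : ℂ) rb rd re rf := by
    rw [Zonal.map_genB]; rfl
  have hmapL : map (algebraMap ℝ ℂ) (Zonal.genL ra rb rd re rf) = Zonal.genL (ra : ℂ) rb rd re rf := by
    rw [Zonal.map_genL]; rfl
  rw [Zonal.genA_smul, ← mul_assoc, ← map_mul, ← hmapA] at hP4c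
  rw [Zonal.genB_smul, ← mul_assoc, ← map_mul, ← hmapB] at hP6c
  have hA0 : Zonal.genA ra rb rd re rf ≠ 0 := by
    intro h0
    rw [h0, map_zero, mul_zero, map_eq_zero_iff _ (map_injective (algebraMap ℝ ℂ) (RCLike.ofReal_injective))] at hP4c
    exact hP4 hP4c
  have hB0 : Zonal.genB ra rb rd re rf ≠ 0 := by
    intro h0
    rw [h0, map_zero, mul_zero, map_eq_zero_iff _ (map_injective (algebraMap ℝ ℂ) (RCLike.ofReal_injective))] at hP6c
    exact hP6 hP6c
  obtain ⟨c₁, hc₁⟩ := LoopLaw.exists_real_smul_of_map_eq_C_mul hA0 hP4c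
  obtain ⟨c₂, hc₂⟩ := LoopLaw.exists_real_smul_of_map_eq_C_mul hB0 hP6c
  rw [smul_eq_C_mul] at hc₁ hc₂
  have hc₁0 : c₁ ≠ 0 := by rintro rfl; exact hP4 (by rw [hc₁, C_0, zero_mul])
  have hc₂0 : c₂ ≠ 0 := by rintro rfl; exact hP6 (by rw [hc₂, C_0, zero_mul])
  have hL0 : Zonal.genL ra rb rd re rf ≠ 0 := by
    intro h0
    apply hq0
    rw [← hgen, Zonal.genL_smul, ← hmapL, h0, map_zero, mul_zero, Zonal.chartT_zero]
  -- the digits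
  rw [hc₁, hc₂] at hE
  obtain ⟨β, γ', hM⟩ := Zonal.exists_genM_eq_of_classIdentity (hP 2 h2K).1 (hP 2 h2K).2.1 hc₁0 hc₂0 hL0 hE
  -- the uniaxial lemma
  obtain ⟨n, hn, hrot⟩ := Zonal.exists_axis_of_genM_eq ra rb rd re rf hM
  refine ⟨n, hn, ?_⟩
  rw [hc₂, Zonal.detP_C_mul_right, Zonal.detP_genB_right, hM, Zonal.detP_add_right, Zonal.detP_C_mul_right,
    Zonal.detP_C_mul_right, Zonal.detP_normSq_right, hrot]
  ring

/-! ### ★★ THM E -/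

/-- The three-shell sum over `K = {2, 4, 6}`. [folklore] -/
theorem twoFourSix_sum_eq (A B Cc : E3 → ℝ) (z : E3) :
    ∑ k ∈ ({2, 4, 6} : Finset ℕ), horizonProfile k ((fun k => if k = 6 then Cc else if k = 4 then B else A) k) 0 z
      = horizonProfile 2 A 0 z + horizonProfile 4 B 0 z + horizonProfile 6 Cc 0 z :=
  threeShell_sum_eq (l := 2) (m := 4) (n := 6) (by norm_num) (by norm_num) (by norm_num) A B Cc z

/-- ★★ **THM E — THE TOWER `{2, 4, 6}` IS COAXIALLY ZONAL AT ORDER ONE.**  Let `A ∈ 𝓗₂` (possibly zero), `B ∈ 𝓗₄`, `C ∈ 𝓗₆` be smooth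
homogeneous harmonic shells with `B, C ≢ 0`.  If the scale-free tower `U_A + U_B + U_C` of their horizon profiles is annihilated by the
order-one horizon law `𝔏₁` off the centre, then the three shells are zonal about ONE common axis `a ≠ 0` (`⟪a × y, ∇·⟫ ≡ 0`).
(With `B ≡ 0` or `C ≡ 0` the tower has two shells and is decided by `twoShellHorizonTowerZonality`, p691920.) [folklore] -/
theorem finiteTower_zonal_of_twoFourSix {A B Cc : E3 → ℝ}
    (hA : ContDiff ℝ (⊤ : ℕ∞) A) (hhomA : ∀ (c : ℝ) (y : E3), A (c • y) = c ^ 2 * A y) (hharmA : ∀ y, Laplacian.laplacian A y = 0)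
    (hB : ContDiff ℝ (⊤ : ℕ∞) B) (hhomB : ∀ (c : ℝ) (y : E3), B (c • y) = c ^ 4 * B y) (hharmB : ∀ y, Laplacian.laplacian B y = 0)
    (hC : ContDiff ℝ (⊤ : ℕ∞) Cc) (hhomC : ∀ (c : ℝ) (y : E3), Cc (c • y) = c ^ 6 * Cc y)
    (hharmC : ∀ y, Laplacian.laplacian Cc y = 0) (hB0 : ∃ y, B y ≠ 0) (hC0 : ∃ y, Cc y ≠ 0)
    (hL1 : ∀ x : E3, x ≠ 0 →
      horizonL1 (fun z => horizonProfile 2 A 0 z + horizonProfile 4 B 0 z + horizonProfile 6 Cc 0 z) 0 x = 0) :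
    ∃ a : E3, a ≠ 0 ∧ (∀ y : E3, ⟪cross a y, gradient A y⟫ = 0) ∧ (∀ y : E3, ⟪cross a y, gradient B y⟫ = 0) ∧
      (∀ y : E3, ⟪cross a y, gradient Cc y⟫ = 0) := by
  classical
  set K : Finset ℕ := {2, 4, 6} with hKdef
  set Hs : ℕ → E3 → ℝ := fun k => if k = 6 then Cc else if k = 4 then B else A with hHs
  have hH2 : Hs 2 = A := by simp [hHs]
  have hH4 : Hs 4 = B := by simp [hHs]
  have hH6 : Hs 6 = Cc := by simp [hHs]
  have hmem : ∀ k ∈ K, k = 2 ∨ k = 4 ∨ k = 6 := fun k hk => by simpa [hKdef] using hk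
  have hK1 : ∀ k ∈ K, 1 ≤ k := by intro k hk; rcases hmem k hk with rfl | rfl | rfl <;> norm_num
  have hHs' : ∀ k ∈ K, ContDiff ℝ (⊤ : ℕ∞) (Hs k) := by
    intro k hk; rcases hmem k hk with rfl | rfl | rfl
    · rw [hH2]; exact hA
    · rw [hH4]; exact hB
    · rw [hH6]; exact hC
  have hhom' : ∀ k ∈ K, ∀ (c : ℝ) (y : E3), Hs k (c • y) = c ^ k * Hs k y := by
    intro k hk; rcases hmem k hk with rfl | rfl | rfl
    · rw [hH2]; exact hhomA
    · rw [hH4]; exact hhomB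
    · rw [hH6]; exact hhomC
  have hharm' : ∀ k ∈ K, ∀ y, Laplacian.laplacian (Hs k) y = 0 := by
    intro k hk; rcases hmem k hk with rfl | rfl | rfl
    · rw [hH2]; exact hharmA
    · rw [hH4]; exact hharmB
    · rw [hH6]; exact hharmC
  have hL1' : ∀ x : E3, x ≠ 0 → horizonL1 (fun z => ∑ k ∈ K, horizonProfile k (Hs k) 0 z) 0 x = 0 := by
    intro x hx
    have hfun : (fun z => ∑ k ∈ K, horizonProfile k (Hs k) 0 z)
        = fun z => horizonProfile 2 A 0 z + horizonProfile 4 B 0 z + horizonProfile 6 Cc 0 z :=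
      funext fun z => twoFourSix_sum_eq A B Cc z
    rw [hfun]; exact hL1 x hx
  obtain ⟨P, hP⟩ := finiteTower_exists_polys K Hs hHs' hhom' hharm'
  have hne : ∀ {l}, l ∈ K → (∃ y, Hs l y ≠ 0) → P l ≠ 0 := by
    intro l hl ⟨y, hy⟩ h
    apply hy
    rw [(hP l hl).2.2 y, h]
    simp [Zonal.evalE]
  have h4K : (4 : ℕ) ∈ K := by simp [hKdef]
  have h6K : (6 : ℕ) ∈ K := by simp [hKdef]
  have hP4 : P 4 ≠ 0 := hne h4K (by rw [hH4]; exact hB0)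
  have hP6 : P 6 ≠ 0 := hne h6K (by rw [hH6]; exact hC0)
  obtain ⟨n, hn, htop⟩ := finiteTower_exists_axis_of_twoFourSix Hs hHs' hhom' hharm' hL1' P hP hP4 hP6
  have hmax : ∀ k ∈ K, k ≤ 6 := by intro k hk; rcases hmem k hk with rfl | rfl | rfl <;> omega
  have hall := finiteTower_detP_lin_eq_zero_of_top K Hs hK1 hHs' hhom' hharm' hL1' P hP h6K hmax hP6 hn htop
  have hna : (WithLp.toLp 2 n : E3) ≠ 0 := by
    intro h
    apply hn
    funext i
    have := congrArg (fun v : E3 => v i) h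
    simpa using this
  have conv : ∀ {l}, l ∈ K → ∀ y : E3, ⟪cross (WithLp.toLp 2 n) y, gradient (Hs l) y⟫ = 0 := by
    intro l hl y
    have h := hall l hl
    rw [Zonal.detP_lin_eq_zero_iff] at h
    have := h y
    rwa [← show Hs l = Zonal.evalE (P l) from funext (hP l hl).2.2] at this
  refine ⟨WithLp.toLp 2 n, hna, ?_, ?_, ?_⟩
  · have := conv (by simp [hKdef] : (2 : ℕ) ∈ K); rwa [hH2] at this
  · have := conv h4K; rwa [hH4] at this
  · have := conv h6K; rwa [hH6] at this

/-- THM E with the ZONAL FUNCTIONAL FORMS of the Defs twin as conclusion. [folklore] -/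
theorem finiteTower_zonalForm_of_twoFourSix {A B Cc : E3 → ℝ}
    (hA : ContDiff ℝ (⊤ : ℕ∞) A) (hhomA : ∀ (c : ℝ) (y : E3), A (c • y) = c ^ 2 * A y) (hharmA : ∀ y, Laplacian.laplacian A y = 0)
    (hB : ContDiff ℝ (⊤ : ℕ∞) B) (hhomB : ∀ (c : ℝ) (y : E3), B (c • y) = c ^ 4 * B y) (hharmB : ∀ y, Laplacian.laplacian B y = 0)
    (hC : ContDiff ℝ (⊤ : ℕ∞) Cc) (hhomC : ∀ (c : ℝ) (y : E3), Cc (c • y) = c ^ 6 * Cc y)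
    (hharmC : ∀ y, Laplacian.laplacian Cc y = 0) (hB0 : ∃ y, B y ≠ 0) (hC0 : ∃ y, Cc y ≠ 0)
    (hL1 : ∀ x : E3, x ≠ 0 →
      horizonL1 (fun z => horizonProfile 2 A 0 z + horizonProfile 4 B 0 z + horizonProfile 6 Cc 0 z) 0 x = 0) :
    ∃ (a : E3) (gA gB gC : ℝ → ℝ), a ≠ 0 ∧
      (∀ y : E3, y ≠ 0 → A y = ‖y‖ ^ 2 * gA (⟪a, y⟫ / ‖y‖)) ∧
      (∀ y : E3, y ≠ 0 → B y = ‖y‖ ^ 4 * gB (⟪a, y⟫ / ‖y‖)) ∧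
      (∀ y : E3, y ≠ 0 → Cc y = ‖y‖ ^ 6 * gC (⟪a, y⟫ / ‖y‖)) := by
  obtain ⟨a, ha, hAa, hBa, hCa⟩ := finiteTower_zonal_of_twoFourSix hA hhomA hharmA hB hhomB hharmB hC hhomC hharmC hB0 hC0 hL1
  obtain ⟨gA, hgA⟩ := exists_zonalForm_of_inner_cross_gradient_eq_zero (l := 2) ha (hA.differentiable (by simp))
    (fun c y _ => hhomA c y) hAa
  obtain ⟨gB, hgB⟩ := exists_zonalForm_of_inner_cross_gradient_eq_zero (l := 4) ha (hB.differentiable (by simp))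
    (fun c y _ => hhomB c y) hBa
  obtain ⟨gC, hgC⟩ := exists_zonalForm_of_inner_cross_gradient_eq_zero (l := 6) ha (hC.differentiable (by simp))
    (fun c y _ => hhomC c y) hCa
  exact ⟨a, gA, gB, gC, ha, hgA, hgB, hgC⟩

end Summit.NavierStokesRegularity.NavierStokesRegularity.Theorems.PoloidalLiouville.HorizonTower

end
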